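import Literature.MathematicalPhysics.QuantumFieldTheory.Balaban1983to89.B4Lower18Regular

/-!
# `Balaban1983to89.B4Prop31Energy` — T. Bałaban, *Regularity and decay of lattice Green's functions*, Commun. Math.
Phys. **89** (1983) 571–597 [Balaban1983RegularityDecay] (= [B4]): §4, p. 589 (4.1)–(4.3) — the VARIATIONAL /
GAUSSIAN REPRESENTATION of the quadratic form of `Δ^{(k)}(Ω,A) = a_kI − a_k²Q_k(A)G_k(Ω,A)Q_k^*(A)` (1.14) for an
ARBITRARY link field (file 1/3 of seat p35 gen 2's proof of «Proposition 3.1′ of [2]» (1.21)–(1.22) at `A ≠ 0`)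

statement-level skeleton of published theorems with citation tags; proofs where landed; nothing here is a claim about
the Yang–Mills mass gap

PDF held: `paper:balaban1983-cmp89-regularity-decay` (journal page = PDF page + 570); p. 573 [PDF 3] (1.14), p. 574
[PDF 4] (1.21)–(1.22), pp. 589–590 [PDF 19–20] §4 (4.1)–(4.7) read (`lit read … --pages 19-23`).

CITATION HEADER (lean-in-tree rule).  Phase-2 PROOF file of the lit-balaban typed skeleton (HOME
`run/shared/lean/pub/lit-balaban/`), SKELETON row **`B4.Prop3.1'[II]`** («Proposition 3.1′ of [2]», owner r01, referee
ref-4; cell status before this seat: proved at `A = 0` only, `B4Prop31Zero`), seat p35 gen 2 (unit `lit-balaban-p35`).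
This file is GENERIC: finite site types `X` (fine), `Y` (unit lattice), colours `ι`, arbitrary bond weights `c`,
block weights `q`, link variables `W` and transporters `T` — the objects of `B4GaugeCovariance` (`covLap`, `avgOp`,
`covOp`, `green`).  Files 2/3 (`B4Prop31Holonomy`, `B4Prop31Regular`) specialise to [B4]'s regions and prove (1.22).

THE PRINTED TEXT (p. 589 [PDF 19], verbatim, `≦` written `≤`): *"4. Proof of the Lower Bound for the Quadratic Form
Δ^{(k)} (Proposition 3.1′).  We will estimate the quadratic form on the left hand side of (1.18) in several ways,
finally getting all the terms on the right hand side.  At first we have G_k(Ω,A) ≤ ((a_kP_k(A) + m²)|_Ω)^{−1} and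
the left side of (1.18) can be estimated from below by Σ_{x∈Ω^{(k)}} [a_k|φ(x)|² − a_k²⟨φ(x), (Q_k(A)((a_kP_k(A) +
m²)|_{B^k(x)})^{−1}Q_k^*(A))(x,x)φ(x)⟩]. (4.1)  Each term of the above sum is determined by the integral
∫dφ′|_{B^k(x)} exp[−½a_k|φ(x) − (Q_k(A)φ′)(x)|² − ½m² Σ_{x′∈B^k(x)} η^d|φ′(x′)|²]. (4.2)  This means that the
integral is equal to const exp[−½(the term of the sum (4.1) corresponding to the point x)]."*  («(1.18)» = (1.22):
the §4 references to §1 displays are low by four, cell transcript GLOBAL ERRATUM.)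

WHAT IS KERNEL-CHECKED HERE (zero `sorry`, standard axioms), for `H = −Δ_W + m² + (a·s)Q^*Q` (`covOp c m² (a·s) q W T`;
[B4]: `s = η^{d}·` volume factor `= n^{−(d+1)}`, DICTIONARY of `B4Lower18`/`B4Prop31Zero`), `G = H^{−1}`,
`Q = avgOp q T` (block SUMS with transporters), and the EFFECTIVE OPERATOR
`keff = a·1 − (a²s)·Q G Qᵀ` (= [B4] (1.14) `Δ^{(k)}(Ω,A)`; = `B4Prop31Zero.KeffR` at `A = 0`):
* §1 `keff_form_eq`; the finite-dimensional content of (4.2) — the exponent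
  `F(Φ′, ψ) = s⟨Φ′, (−Δ_W + m²)Φ′⟩ + a|ψ − sQΦ′|²` (`cenergy`), its expansion `cenergy_expand`, its critical point
  `Φ⋆ = aGQᵀψ` (`gStar`) and **`cenergy_gStar`: `F(Φ⋆, ψ) = ⟨ψ, Δ^{(k)}ψ⟩`** (the Gaussian integral (4.2) equals
  `const·exp[−½ F(Φ⋆,ψ)]`; we certify the algebra, not the integral), plus `cenergy_ge_keff`: `F(Φ′,ψ) ≥ ⟨ψ,Δ^{(k)}ψ⟩`
  for every `Φ′` when `H ≥ γ > 0`;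
* §2 JENSEN ON BLOCKS with orthogonal transporters (`avg_sq_le`, `sum_avg_sq_le`: `Σ_y|sQΦ(y)|² ≤ s|Φ|²`), the bound
  `|Qᵀψ|² ≤ N|ψ|²` (`adj_sq_le`), the size of the critical point `s|Φ⋆|² ≤ (a/γ)²|ψ|²` under `H ≥ γ` (`gStar_sq_le`),
  and the mass step of (4.4) in the form `m²|ψ|² ≤ 2m²|ψ − sQΦ|² + 2m²s|Φ|²` (`mass_le`);
* §3 `assemble`: the real-arithmetic combination used by file 3.
Unit `lit-balaban-p35` (gen 2), HOME as above.
-/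

namespace Literature.MathematicalPhysics.QuantumFieldTheory.Balaban1983to89.B4Prop31Energy

open Matrix Finset
open Literature.MathematicalPhysics.QuantumFieldTheory.Balaban1983to89.B4GaugeCovariance
open Literature.MathematicalPhysics.QuantumFieldTheory.Balaban1983to89.B4Lower18Regular
  (dotProduct_self_nonneg' orth_dotProduct_mulVec_self dotProduct_eq_sum_fld covOp_form isUnit_det_of_form_ge
    inv_mulVec_sq_le sum_smul_dotProduct_self_le)

noncomputable section

section Generic

variable {X Y ι : Type*} [Fintype X] [Fintype Y] [Fintype ι] [DecidableEq X] [DecidableEq Y] [DecidableEq ι]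

/-! ## §1  `Δ^{(k)}(Ω, A)` for an arbitrary link field and the variational representation (4.1)–(4.3) -/

/-- **[B4] (1.14) `Δ^{(k)}(Ω,A) = a_kI − a_k²Q_k(A)G_k(Ω,A)Q_k^*(A)`** for ARBITRARY weights, link variables and
transporters, in the lineage's dictionary (`Q_k = s·Q` with `Q = avgOp q T` the transported block sums, `Q_k^* = Qᵀ`,
`G_k = (covOp c m² (a·s) q W T)⁻¹`, `s = n^{−(d+1)}`): the matrix `a·1 − (a²s)·Q·G·Qᵀ` on unit-lattice fields.
[cite: Balaban1983RegularityDecay, p. 573 (1.14)] -/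
def keff (c : X → X → ℝ) (m2 a s : ℝ) (q : Y → X → ℝ) (W : X → X → Matrix ι ι ℝ)
    (T : Y → X → Matrix ι ι ℝ) : Matrix (Y × ι) (Y × ι) ℝ :=
  a • (1 : Matrix (Y × ι) (Y × ι) ℝ)
    - (a ^ 2 * s) • (avgOp q T * green c m2 (a * s) q W T * (avgOp q T)ᵀ)

/-- the form of `Δ^{(k)}`: `⟨ψ, Δ^{(k)}ψ⟩ = a|ψ|² − a²s·⟨Qᵀψ, G Qᵀψ⟩`. [cite: Balaban1983RegularityDecay, p. 573 (1.14)] -/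
theorem keff_form_eq (c : X → X → ℝ) (m2 a s : ℝ) (q : Y → X → ℝ) (W : X → X → Matrix ι ι ℝ)
    (T : Y → X → Matrix ι ι ℝ) (ψ : Y × ι → ℝ) :
    ψ ⬝ᵥ (keff c m2 a s q W T *ᵥ ψ)
      = a * (ψ ⬝ᵥ ψ) - a ^ 2 * s *
          (((avgOp q T)ᵀ *ᵥ ψ) ⬝ᵥ (green c m2 (a * s) q W T *ᵥ ((avgOp q T)ᵀ *ᵥ ψ))) := by
  rw [keff, Matrix.sub_mulVec, Matrix.smul_mulVec, Matrix.one_mulVec, dotProduct_sub, dotProduct_smul,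
    smul_eq_mul, Matrix.smul_mulVec, dotProduct_smul, smul_eq_mul, ← Matrix.mulVec_mulVec, ← Matrix.mulVec_mulVec,
    Matrix.dotProduct_mulVec ψ (avgOp q T), ← Matrix.mulVec_transpose]

/-- THE EXPONENT OF (4.2): `F(Φ′, ψ) = s·⟨Φ′, (−Δ_W + m²)Φ′⟩ + a·|ψ − s·QΦ′|²` — the fine kinetic-plus-mass energy of
`Φ′` plus the averaging constraint penalty (print: `½a_k|φ(x) − (Q_k(A)φ′)(x)|² + ½m²Σ η^d|φ′(x′)|²`, with the
kinetic term of (1.6) restored for the full operator). [cite: Balaban1983RegularityDecay, p. 589 (4.2)] -/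
def cenergy (c : X → X → ℝ) (m2 a s : ℝ) (q : Y → X → ℝ) (W : X → X → Matrix ι ι ℝ)
    (T : Y → X → Matrix ι ι ℝ) (Φ : X × ι → ℝ) (ψ : Y × ι → ℝ) : ℝ :=
  s * (Φ ⬝ᵥ ((covLap c W + m2 • (1 : Matrix (X × ι) (X × ι) ℝ)) *ᵥ Φ))
    + a * ((ψ - s • (avgOp q T *ᵥ Φ)) ⬝ᵥ (ψ - s • (avgOp q T *ᵥ Φ)))

/-- THE CRITICAL POINT of the exponent (4.2): `Φ⋆ = a·G·Qᵀψ` (`= a_kG_k(Ω,A)Q_k^*(A)φ`).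
[cite: Balaban1983RegularityDecay, p. 589 (4.2)–(4.3)] -/
def gStar (c : X → X → ℝ) (m2 a s : ℝ) (q : Y → X → ℝ) (W : X → X → Matrix ι ι ℝ)
    (T : Y → X → Matrix ι ι ℝ) (ψ : Y × ι → ℝ) : X × ι → ℝ :=
  a • (green c m2 (a * s) q W T *ᵥ ((avgOp q T)ᵀ *ᵥ ψ))

omit [DecidableEq Y] in
/-- completing the square in the exponent of (4.2): `F(Φ′,ψ) = s⟨Φ′, HΦ′⟩ − 2as⟨Qᵀψ, Φ′⟩ + a|ψ|²` with
`H = −Δ_W + m² + (as)QᵀQ` the operator of (1.6). [cite: Balaban1983RegularityDecay, p. 589 (4.2), algebra] -/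
theorem cenergy_expand (c : X → X → ℝ) (m2 a s : ℝ) (q : Y → X → ℝ) (W : X → X → Matrix ι ι ℝ)
    (T : Y → X → Matrix ι ι ℝ) (Φ : X × ι → ℝ) (ψ : Y × ι → ℝ) :
    cenergy c m2 a s q W T Φ ψ
      = s * (Φ ⬝ᵥ (covOp c m2 (a * s) q W T *ᵥ Φ)) - 2 * a * s * (((avgOp q T)ᵀ *ᵥ ψ) ⬝ᵥ Φ)
        + a * (ψ ⬝ᵥ ψ) := by
  have hH : Φ ⬝ᵥ (covOp c m2 (a * s) q W T *ᵥ Φ)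
      = Φ ⬝ᵥ (covLap c W *ᵥ Φ) + m2 * (Φ ⬝ᵥ Φ) + a * s * ((avgOp q T *ᵥ Φ) ⬝ᵥ (avgOp q T *ᵥ Φ)) := by
    rw [covOp_form, projOp_form]
  have hK : Φ ⬝ᵥ ((covLap c W + m2 • (1 : Matrix (X × ι) (X × ι) ℝ)) *ᵥ Φ)
      = Φ ⬝ᵥ (covLap c W *ᵥ Φ) + m2 * (Φ ⬝ᵥ Φ) := by
    rw [Matrix.add_mulVec, Matrix.smul_mulVec, Matrix.one_mulVec, dotProduct_add, dotProduct_smul, smul_eq_mul]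
  have hcross : ψ ⬝ᵥ (avgOp q T *ᵥ Φ) = ((avgOp q T)ᵀ *ᵥ ψ) ⬝ᵥ Φ := by
    rw [Matrix.dotProduct_mulVec, ← Matrix.mulVec_transpose]
  have hsq : (ψ - s • (avgOp q T *ᵥ Φ)) ⬝ᵥ (ψ - s • (avgOp q T *ᵥ Φ))
      = ψ ⬝ᵥ ψ - 2 * s * (ψ ⬝ᵥ (avgOp q T *ᵥ Φ))
        + s ^ 2 * ((avgOp q T *ᵥ Φ) ⬝ᵥ (avgOp q T *ᵥ Φ)) := by
    simp only [sub_dotProduct, dotProduct_sub, smul_dotProduct, dotProduct_smul, smul_eq_mul,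
      dotProduct_comm (avgOp q T *ᵥ Φ) ψ]
    ring
  rw [cenergy, hK, hsq, hH, hcross]
  ring

omit [DecidableEq Y] in
/-- the critical-point equation of (4.2): under invertibility, `H Φ⋆ = a·Qᵀψ`.
[cite: Balaban1983RegularityDecay, p. 589 (4.2)–(4.3), algebra] -/
theorem covOp_mulVec_gStar {c : X → X → ℝ} {m2 a s : ℝ} {q : Y → X → ℝ} {W : X → X → Matrix ι ι ℝ}
    {T : Y → X → Matrix ι ι ℝ} (hH : IsUnit (covOp c m2 (a * s) q W T).det) (ψ : Y × ι → ℝ) :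
    covOp c m2 (a * s) q W T *ᵥ gStar c m2 a s q W T ψ = a • ((avgOp q T)ᵀ *ᵥ ψ) := by
  rw [gStar, Matrix.mulVec_smul, green, Matrix.mulVec_mulVec, Matrix.mul_nonsing_inv _ hH, Matrix.one_mulVec]

/-- **(4.2)–(4.3), THE VARIATIONAL VALUE**: at the critical point the exponent of the Gaussian integral (4.2) IS the
quadratic form of `Δ^{(k)}(Ω,A)`: `F(Φ⋆, ψ) = ⟨ψ, Δ^{(k)}ψ⟩` (*"the integral is equal to const exp[−½(the term of the
sum (4.1) …)]"*; finite-dimensional Schur-complement identity, valid for every link field once `H` is invertible).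
[cite: Balaban1983RegularityDecay, p. 589 (4.2)–(4.3)] -/
theorem cenergy_gStar {c : X → X → ℝ} {m2 a s : ℝ} {q : Y → X → ℝ} {W : X → X → Matrix ι ι ℝ}
    {T : Y → X → Matrix ι ι ℝ} (hH : IsUnit (covOp c m2 (a * s) q W T).det) (ψ : Y × ι → ℝ) :
    cenergy c m2 a s q W T (gStar c m2 a s q W T ψ) ψ = ψ ⬝ᵥ (keff c m2 a s q W T *ᵥ ψ) := by
  rw [cenergy_expand, keff_form_eq, covOp_mulVec_gStar hH]
  set f := (avgOp q T)ᵀ *ᵥ ψ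
  have h1 : gStar c m2 a s q W T ψ ⬝ᵥ (a • f) = a * (a * (f ⬝ᵥ (green c m2 (a * s) q W T *ᵥ f))) := by
    rw [gStar, dotProduct_smul, smul_dotProduct, smul_eq_mul, smul_eq_mul, dotProduct_comm]
  have h2 : f ⬝ᵥ gStar c m2 a s q W T ψ = a * (f ⬝ᵥ (green c m2 (a * s) q W T *ᵥ f)) := by
    rw [gStar, dotProduct_smul, smul_eq_mul]
  rw [h1, h2]
  ring

/-- **THE MINIMUM PROPERTY** (why the Gaussian integral (4.2) is governed by `Φ⋆`): if `H ≥ γ > 0` then for EVERY fine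
field `Φ′`, `F(Φ′, ψ) ≥ ⟨ψ, Δ^{(k)}ψ⟩` whenever `s ≥ 0` (`F(Φ′,ψ) − F(Φ⋆,ψ) = s⟨Φ′ − Φ⋆, H(Φ′ − Φ⋆)⟩`).
[cite: Balaban1983RegularityDecay, p. 589 (4.1)–(4.3)] -/
theorem cenergy_ge_keff {c : X → X → ℝ} {m2 a s : ℝ} {q : Y → X → ℝ} {W : X → X → Matrix ι ι ℝ}
    {T : Y → X → Matrix ι ι ℝ} {γ : ℝ} (hγ : 0 < γ) (hs : 0 ≤ s)
    (hH : ∀ v, γ * (v ⬝ᵥ v) ≤ v ⬝ᵥ (covOp c m2 (a * s) q W T *ᵥ v)) (Φ : X × ι → ℝ) (ψ : Y × ι → ℝ) :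
    ψ ⬝ᵥ (keff c m2 a s q W T *ᵥ ψ) ≤ cenergy c m2 a s q W T Φ ψ := by
  have hu : IsUnit (covOp c m2 (a * s) q W T).det := isUnit_det_of_form_ge hγ hH
  set H := covOp c m2 (a * s) q W T with hHdef
  set g := gStar c m2 a s q W T ψ with hg
  have hHg : H *ᵥ g = a • ((avgOp q T)ᵀ *ᵥ ψ) := covOp_mulVec_gStar hu ψ
  -- symmetry of `H`: `u ⬝ Hv = v ⬝ Hu`
  have hsymm : ∀ u v : X × ι → ℝ, u ⬝ᵥ (H *ᵥ v) = v ⬝ᵥ (H *ᵥ u) := by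
    intro u v
    have hT : Hᵀ = H := by
      rw [hHdef, covOp, covLap, projOp]
      simp only [Matrix.transpose_add, Matrix.transpose_smul, Matrix.transpose_one, Matrix.transpose_mul,
        Matrix.transpose_transpose, Matrix.transpose_sum]
    calc u ⬝ᵥ (H *ᵥ v) = (u ᵥ* H) ⬝ᵥ v := (Matrix.dotProduct_mulVec u H v)
      _ = (Hᵀ *ᵥ u) ⬝ᵥ v := by rw [Matrix.mulVec_transpose]
      _ = v ⬝ᵥ (H *ᵥ u) := by rw [hT, dotProduct_comm]
  have hdiff : cenergy c m2 a s q W T Φ ψ - cenergy c m2 a s q W T g ψ = s * ((Φ - g) ⬝ᵥ (H *ᵥ (Φ - g))) := by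
    rw [cenergy_expand, cenergy_expand]
    have e1 : (Φ - g) ⬝ᵥ (H *ᵥ (Φ - g)) = Φ ⬝ᵥ (H *ᵥ Φ) - 2 * (g ⬝ᵥ (H *ᵥ Φ)) + g ⬝ᵥ (H *ᵥ g) := by
      rw [Matrix.mulVec_sub, sub_dotProduct, dotProduct_sub, dotProduct_sub, hsymm Φ g]
      ring
    have e2 : g ⬝ᵥ (H *ᵥ Φ) = a * (((avgOp q T)ᵀ *ᵥ ψ) ⬝ᵥ Φ) := by
      rw [hsymm g Φ, hHg, dotProduct_smul, smul_eq_mul, dotProduct_comm]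
    have e3 : g ⬝ᵥ (H *ᵥ g) = a * (((avgOp q T)ᵀ *ᵥ ψ) ⬝ᵥ g) := by
      rw [hHg, dotProduct_smul, smul_eq_mul, dotProduct_comm]
    rw [e1, e2, e3]
    ring
  have hpos : 0 ≤ s * ((Φ - g) ⬝ᵥ (H *ᵥ (Φ - g))) :=
    mul_nonneg hs (le_trans (mul_nonneg hγ.le (dotProduct_self_nonneg' _)) (hH _))
  rw [← cenergy_gStar hu ψ]
  linarith

/-! ## §2  Jensen on blocks with orthogonal transporters; the size of the critical point -/

omit [Fintype Y] [DecidableEq X] [DecidableEq Y] in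
/-- **JENSEN ON ONE BLOCK**: for weights `q(y,·) ≥ 0` with `Σ_x q(y,x) ≤ N`, `s·N ≤ 1`, `s ≥ 0`, and transporters
orthogonal where the weight is non-zero: `|s·(QΦ)(y)|² ≤ s·Σ_x q(y,x)|φ(x)|²` (the block average (1.4) does not
increase the mean square; the step behind (4.4)). [cite: Balaban1983RegularityDecay, p. 572 (1.4), p. 589 (4.4)] -/
theorem avg_sq_le {q : Y → X → ℝ} (hq : ∀ y x, 0 ≤ q y x) {N s : ℝ} (hs : 0 ≤ s) (hsN : s * N ≤ 1)
    (hrow : ∀ y, ∑ x, q y x ≤ N) {T : Y → X → Matrix ι ι ℝ} (hT : ∀ y x, q y x ≠ 0 → (T y x)ᵀ * T y x = 1)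
    (Φ : X × ι → ℝ) (y : Y) :
    (s • fld (avgOp q T *ᵥ Φ) y) ⬝ᵥ (s • fld (avgOp q T *ᵥ Φ) y) ≤ s * ∑ x, q y x * (fld Φ x ⬝ᵥ fld Φ x) := by
  rw [fld_avgOp_mulVec, smul_dotProduct, dotProduct_smul, smul_eq_mul, smul_eq_mul]
  have hcs := sum_smul_dotProduct_self_le Finset.univ (hq y) (fun x => T y x *ᵥ fld Φ x)
  have horth : ∀ x, q y x * ((T y x *ᵥ fld Φ x) ⬝ᵥ (T y x *ᵥ fld Φ x)) = q y x * (fld Φ x ⬝ᵥ fld Φ x) := by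
    intro x
    by_cases h : q y x = 0
    · rw [h, zero_mul, zero_mul]
    · rw [orth_dotProduct_mulVec_self (hT y x h)]
  simp only [horth] at hcs
  have hS : 0 ≤ ∑ x, q y x * (fld Φ x ⬝ᵥ fld Φ x) :=
    Finset.sum_nonneg fun x _ => mul_nonneg (hq y x) (dotProduct_self_nonneg' _)
  calc s * (s * ((∑ x, q y x • (T y x *ᵥ fld Φ x)) ⬝ᵥ (∑ x, q y x • (T y x *ᵥ fld Φ x))))
      ≤ s * (s * ((∑ x, q y x) * ∑ x, q y x * (fld Φ x ⬝ᵥ fld Φ x))) :=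
        mul_le_mul_of_nonneg_left (mul_le_mul_of_nonneg_left hcs hs) hs
    _ ≤ s * (s * (N * ∑ x, q y x * (fld Φ x ⬝ᵥ fld Φ x))) :=
        mul_le_mul_of_nonneg_left (mul_le_mul_of_nonneg_left (mul_le_mul_of_nonneg_right (hrow y) hS) hs) hs
    _ = (s * N) * (s * ∑ x, q y x * (fld Φ x ⬝ᵥ fld Φ x)) := by ring
    _ ≤ 1 * (s * ∑ x, q y x * (fld Φ x ⬝ᵥ fld Φ x)) :=
        mul_le_mul_of_nonneg_right hsN (mul_nonneg hs hS)
    _ = s * ∑ x, q y x * (fld Φ x ⬝ᵥ fld Φ x) := one_mul _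

omit [DecidableEq X] [DecidableEq Y] in
/-- **JENSEN SUMMED OVER THE BLOCKS**: with column sums `Σ_y q(y,x) ≤ 1` in addition, `Σ_y |s·(QΦ)(y)|² ≤ s|Φ|²`
(`‖Q_kφ‖² ≤ N⁻¹‖φ‖²`, the mass step behind (4.4)). [cite: Balaban1983RegularityDecay, p. 589 (4.4)] -/
theorem sum_avg_sq_le {q : Y → X → ℝ} (hq : ∀ y x, 0 ≤ q y x) {N s : ℝ} (hs : 0 ≤ s) (hsN : s * N ≤ 1)
    (hrow : ∀ y, ∑ x, q y x ≤ N) (hcol : ∀ x, ∑ y, q y x ≤ 1) {T : Y → X → Matrix ι ι ℝ}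
    (hT : ∀ y x, q y x ≠ 0 → (T y x)ᵀ * T y x = 1) (Φ : X × ι → ℝ) :
    ∑ y, (s • fld (avgOp q T *ᵥ Φ) y) ⬝ᵥ (s • fld (avgOp q T *ᵥ Φ) y) ≤ s * (Φ ⬝ᵥ Φ) := by
  have hn : ∀ x, 0 ≤ fld Φ x ⬝ᵥ fld Φ x := fun x => dotProduct_self_nonneg' _
  calc ∑ y, (s • fld (avgOp q T *ᵥ Φ) y) ⬝ᵥ (s • fld (avgOp q T *ᵥ Φ) y)
      ≤ ∑ y, s * ∑ x, q y x * (fld Φ x ⬝ᵥ fld Φ x) :=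
        Finset.sum_le_sum fun y _ => avg_sq_le hq hs hsN hrow hT Φ y
    _ = s * ∑ x, (∑ y, q y x) * (fld Φ x ⬝ᵥ fld Φ x) := by
        rw [← Finset.mul_sum, Finset.sum_comm]
        simp only [Finset.sum_mul]
    _ ≤ s * ∑ x, 1 * (fld Φ x ⬝ᵥ fld Φ x) :=
        mul_le_mul_of_nonneg_left (Finset.sum_le_sum fun x _ => mul_le_mul_of_nonneg_right (hcol x) (hn x)) hs
    _ = s * (Φ ⬝ᵥ Φ) := by simp only [one_mul, dotProduct_eq_sum_fld Φ Φ]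

omit [DecidableEq X] [DecidableEq Y] [DecidableEq ι] in
/-- the squared residual `|ψ − sQΦ|²` (the `a_k`-term of (4.2)) is the sum over blocks of `|ψ(y) − s(QΦ)(y)|²`.
[cite: Balaban1983RegularityDecay, p. 589 (4.2), algebra] -/
theorem resid_sq_eq (s : ℝ) (q : Y → X → ℝ) (T : Y → X → Matrix ι ι ℝ) (Φ : X × ι → ℝ) (ψ : Y × ι → ℝ) :
    (ψ - s • (avgOp q T *ᵥ Φ)) ⬝ᵥ (ψ - s • (avgOp q T *ᵥ Φ))
      = ∑ y, (fld ψ y - s • fld (avgOp q T *ᵥ Φ) y) ⬝ᵥ (fld ψ y - s • fld (avgOp q T *ᵥ Φ) y) := by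
  rw [dotProduct_eq_sum_fld]
  rfl

omit [DecidableEq X] [DecidableEq Y] in
/-- **THE MASS STEP OF (4.4)** in quadratic-form shape: `m²|ψ|² ≤ 2m²|ψ − sQΦ|² + 2m²s|Φ|²` (parallelogram bound +
Jensen; the print's exact single-block value is `a_km²/(a_k + m²)`). [cite: Balaban1983RegularityDecay, p. 589 (4.4)] -/
theorem mass_le {q : Y → X → ℝ} (hq : ∀ y x, 0 ≤ q y x) {N s : ℝ} (hs : 0 ≤ s) (hsN : s * N ≤ 1)
    (hrow : ∀ y, ∑ x, q y x ≤ N) (hcol : ∀ x, ∑ y, q y x ≤ 1) {T : Y → X → Matrix ι ι ℝ}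
    (hT : ∀ y x, q y x ≠ 0 → (T y x)ᵀ * T y x = 1) {m2 : ℝ} (hm : 0 ≤ m2) (Φ : X × ι → ℝ) (ψ : Y × ι → ℝ) :
    m2 * (ψ ⬝ᵥ ψ) ≤ 2 * m2 * ((ψ - s • (avgOp q T *ᵥ Φ)) ⬝ᵥ (ψ - s • (avgOp q T *ᵥ Φ)))
      + 2 * m2 * (s * (Φ ⬝ᵥ Φ)) := by
  have hJ := sum_avg_sq_le hq hs hsN hrow hcol hT Φ
  have hpt : ∀ y, fld ψ y ⬝ᵥ fld ψ y
      ≤ 2 * ((fld ψ y - s • fld (avgOp q T *ᵥ Φ) y) ⬝ᵥ (fld ψ y - s • fld (avgOp q T *ᵥ Φ) y))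
        + 2 * ((s • fld (avgOp q T *ᵥ Φ) y) ⬝ᵥ (s • fld (avgOp q T *ᵥ Φ) y)) := by
    intro y
    set u := fld ψ y - s • fld (avgOp q T *ᵥ Φ) y
    set v := s • fld (avgOp q T *ᵥ Φ) y
    have huv : fld ψ y = u + v := by simp [u, v]
    have h0 := dotProduct_self_nonneg' (u - v)
    rw [huv]
    have : (u + v) ⬝ᵥ (u + v) + (u - v) ⬝ᵥ (u - v) = 2 * (u ⬝ᵥ u) + 2 * (v ⬝ᵥ v) := by
      simp only [add_dotProduct, dotProduct_add, sub_dotProduct, dotProduct_sub, dotProduct_comm v u]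
      ring
    linarith
  have hsum : ψ ⬝ᵥ ψ ≤ 2 * ((ψ - s • (avgOp q T *ᵥ Φ)) ⬝ᵥ (ψ - s • (avgOp q T *ᵥ Φ))) + 2 * (s * (Φ ⬝ᵥ Φ)) := by
    rw [dotProduct_eq_sum_fld ψ ψ, resid_sq_eq]
    calc ∑ y, fld ψ y ⬝ᵥ fld ψ y
        ≤ ∑ y, (2 * ((fld ψ y - s • fld (avgOp q T *ᵥ Φ) y) ⬝ᵥ (fld ψ y - s • fld (avgOp q T *ᵥ Φ) y))
            + 2 * ((s • fld (avgOp q T *ᵥ Φ) y) ⬝ᵥ (s • fld (avgOp q T *ᵥ Φ) y))) :=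
          Finset.sum_le_sum fun y _ => hpt y
      _ = 2 * ∑ y, (fld ψ y - s • fld (avgOp q T *ᵥ Φ) y) ⬝ᵥ (fld ψ y - s • fld (avgOp q T *ᵥ Φ) y)
          + 2 * ∑ y, (s • fld (avgOp q T *ᵥ Φ) y) ⬝ᵥ (s • fld (avgOp q T *ᵥ Φ) y) := by
          rw [Finset.sum_add_distrib, Finset.mul_sum, Finset.mul_sum]
      _ ≤ _ := by linarith
  have := mul_le_mul_of_nonneg_left hsum hm
  linarith

omit [DecidableEq X] [DecidableEq Y] in
/-- **THE ADJOINT IS BOUNDED BY THE BLOCK SIZE**: `|Qᵀψ|² ≤ N|ψ|²` for weights `q ≥ 0` with row sums `≤ N`, column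
sums `≤ 1` and transporters orthogonal on the support (for [B4]'s (1.4)–(1.5): `Q_kQ_k^* = 1`, so this is an
equality). [cite: Balaban1983RegularityDecay, p. 572 (1.4)–(1.5)] -/
theorem adj_sq_le {q : Y → X → ℝ} (hq : ∀ y x, 0 ≤ q y x) {N : ℝ} (hrow : ∀ y, ∑ x, q y x ≤ N)
    (hcol : ∀ x, ∑ y, q y x ≤ 1) {T : Y → X → Matrix ι ι ℝ} (hT : ∀ y x, q y x ≠ 0 → (T y x)ᵀ * T y x = 1)
    (ψ : Y × ι → ℝ) :
    ((avgOp q T)ᵀ *ᵥ ψ) ⬝ᵥ ((avgOp q T)ᵀ *ᵥ ψ) ≤ N * (ψ ⬝ᵥ ψ) := by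
  have hadj : (avgOp q T)ᵀ = blockOp fun x y => q y x • (T y x)ᵀ := by
    rw [avgOp, blockOp_transpose]
    rfl
  have hfld : ∀ x, fld ((avgOp q T)ᵀ *ᵥ ψ) x = ∑ y, q y x • ((T y x)ᵀ *ᵥ fld ψ y) := by
    intro x
    rw [hadj, fld_blockOp_mulVec]
    simp [Matrix.smul_mulVec]
  have hTT : ∀ y x, q y x ≠ 0 → ((T y x)ᵀ)ᵀ * (T y x)ᵀ = 1 := by
    intro y x h
    rw [Matrix.transpose_transpose]
    exact mul_eq_one_comm.1 (hT y x h)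
  have hn : ∀ y, 0 ≤ fld ψ y ⬝ᵥ fld ψ y := fun y => dotProduct_self_nonneg' _
  have hx : ∀ x, fld ((avgOp q T)ᵀ *ᵥ ψ) x ⬝ᵥ fld ((avgOp q T)ᵀ *ᵥ ψ) x ≤ ∑ y, q y x * (fld ψ y ⬝ᵥ fld ψ y) := by
    intro x
    rw [hfld]
    have hcs := sum_smul_dotProduct_self_le Finset.univ (fun y => hq y x) (fun y => (T y x)ᵀ *ᵥ fld ψ y)
    have horth : ∀ y, q y x * (((T y x)ᵀ *ᵥ fld ψ y) ⬝ᵥ ((T y x)ᵀ *ᵥ fld ψ y)) = q y x * (fld ψ y ⬝ᵥ fld ψ y) := by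
      intro y
      by_cases h : q y x = 0
      · rw [h, zero_mul, zero_mul]
      · rw [orth_dotProduct_mulVec_self (hTT y x h)]
    simp only [horth] at hcs
    have hS : 0 ≤ ∑ y, q y x * (fld ψ y ⬝ᵥ fld ψ y) := Finset.sum_nonneg fun y _ => mul_nonneg (hq y x) (hn y)
    calc _ ≤ (∑ y, q y x) * ∑ y, q y x * (fld ψ y ⬝ᵥ fld ψ y) := hcs
      _ ≤ 1 * ∑ y, q y x * (fld ψ y ⬝ᵥ fld ψ y) := mul_le_mul_of_nonneg_right (hcol x) hS
      _ = _ := one_mul _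
  rw [dotProduct_eq_sum_fld ((avgOp q T)ᵀ *ᵥ ψ)]
  calc ∑ x, fld ((avgOp q T)ᵀ *ᵥ ψ) x ⬝ᵥ fld ((avgOp q T)ᵀ *ᵥ ψ) x
      ≤ ∑ x, ∑ y, q y x * (fld ψ y ⬝ᵥ fld ψ y) := Finset.sum_le_sum fun x _ => hx x
    _ = ∑ y, (∑ x, q y x) * (fld ψ y ⬝ᵥ fld ψ y) := by
        rw [Finset.sum_comm]
        simp only [Finset.sum_mul]
    _ ≤ ∑ y, N * (fld ψ y ⬝ᵥ fld ψ y) := Finset.sum_le_sum fun y _ => mul_le_mul_of_nonneg_right (hrow y) (hn y)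
    _ = N * (ψ ⬝ᵥ ψ) := by rw [← Finset.mul_sum, dotProduct_eq_sum_fld ψ ψ]

omit [DecidableEq Y] in
/-- **THE SIZE OF THE CRITICAL POINT** (where [B4] p. 590 uses Lemma 2.1 «the remaining terms can be easily estimated»):
if `H ≥ γ > 0` then `s|Φ⋆|² ≤ (a/γ)²|ψ|²` (`|GQᵀψ| ≤ γ⁻¹|Qᵀψ|`, `|Qᵀψ|² ≤ N|ψ|²`, `sN ≤ 1`).
[cite: Balaban1983RegularityDecay, Lemma 2.1 (2.15) p. 577, first member, as used on p. 590] -/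
theorem gStar_sq_le {c : X → X → ℝ} {m2 a s : ℝ} {q : Y → X → ℝ} (hq : ∀ y x, 0 ≤ q y x) {N : ℝ}
    (hs : 0 ≤ s) (hsN : s * N ≤ 1) (hrow : ∀ y, ∑ x, q y x ≤ N) (hcol : ∀ x, ∑ y, q y x ≤ 1)
    {W : X → X → Matrix ι ι ℝ} {T : Y → X → Matrix ι ι ℝ} (hT : ∀ y x, q y x ≠ 0 → (T y x)ᵀ * T y x = 1)
    {γ : ℝ} (hγ : 0 < γ) (hH : ∀ v, γ * (v ⬝ᵥ v) ≤ v ⬝ᵥ (covOp c m2 (a * s) q W T *ᵥ v)) (ψ : Y × ι → ℝ) :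
    s * (gStar c m2 a s q W T ψ ⬝ᵥ gStar c m2 a s q W T ψ) ≤ (a / γ) ^ 2 * (ψ ⬝ᵥ ψ) := by
  set f := (avgOp q T)ᵀ *ᵥ ψ
  have h1 := inv_mulVec_sq_le hγ hH f
  have h2 := adj_sq_le hq hrow hcol hT ψ
  have hψ := dotProduct_self_nonneg' ψ
  have hG : (green c m2 (a * s) q W T *ᵥ f) ⬝ᵥ (green c m2 (a * s) q W T *ᵥ f) ≤ γ⁻¹ ^ 2 * (N * (ψ ⬝ᵥ ψ)) := by
    rw [green]
    have hγ2 : 0 < γ ^ 2 := by positivity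
    calc _ = γ⁻¹ ^ 2 * (γ ^ 2 * (((covOp c m2 (a * s) q W T)⁻¹ *ᵥ f) ⬝ᵥ ((covOp c m2 (a * s) q W T)⁻¹ *ᵥ f))) := by
          field_simp
      _ ≤ γ⁻¹ ^ 2 * (f ⬝ᵥ f) := mul_le_mul_of_nonneg_left h1 (by positivity)
      _ ≤ γ⁻¹ ^ 2 * (N * (ψ ⬝ᵥ ψ)) := mul_le_mul_of_nonneg_left h2 (by positivity)
  have hg : gStar c m2 a s q W T ψ ⬝ᵥ gStar c m2 a s q W T ψ
      = a ^ 2 * ((green c m2 (a * s) q W T *ᵥ f) ⬝ᵥ (green c m2 (a * s) q W T *ᵥ f)) := by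
    rw [gStar, smul_dotProduct, dotProduct_smul, smul_eq_mul, smul_eq_mul]
    ring
  rw [hg]
  calc s * (a ^ 2 * ((green c m2 (a * s) q W T *ᵥ f) ⬝ᵥ (green c m2 (a * s) q W T *ᵥ f)))
      ≤ s * (a ^ 2 * (γ⁻¹ ^ 2 * (N * (ψ ⬝ᵥ ψ)))) :=
        mul_le_mul_of_nonneg_left (mul_le_mul_of_nonneg_left hG (sq_nonneg a)) hs
    _ = (a / γ) ^ 2 * ((s * N) * (ψ ⬝ᵥ ψ)) := by field_simp
    _ ≤ (a / γ) ^ 2 * (1 * (ψ ⬝ᵥ ψ)) :=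
        mul_le_mul_of_nonneg_left (mul_le_mul_of_nonneg_right hsN hψ) (sq_nonneg _)
    _ = (a / γ) ^ 2 * (ψ ⬝ᵥ ψ) := by rw [one_mul]

end Generic

/-! ## §3  The real arithmetic of the assembly (p. 590 «Then γ₀ = ½min{…}»-style bookkeeping for file 3) -/

/-- **ASSEMBLY ARITHMETIC**: from the covariant averaging inequality `E ≤ 6D·R + 6D·ω²·P + 24·K` (file 3; `R` = the
residual `|ψ − sQΦ⋆|²`, `P = s|Φ⋆|²`, `K = s⟨Φ⋆, −Δ_WΦ⋆⟩`), the mass step `M ≤ 2m²R + 2m²P` (`M = m²|ψ|²`) and the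
energy identity `F = K + m²P + aR`: `E + M ≤ max((6D + 2m²)/a, 24)·F + 6Dω²P` (our explicit version of p. 590
«Then γ₀ = ½min{γ₀′/(2d), a_k/(a_k + O(1))}»). [cite: Balaban1983RegularityDecay, p. 590, bookkeeping] -/
theorem assemble {E M R K P F ω a m2 D : ℝ} (ha : 0 < a) (hm : 0 ≤ m2) (hR : 0 ≤ R) (hK : 0 ≤ K)
    (hP : 0 ≤ P) (hE : E ≤ 6 * D * R + 6 * D * ω ^ 2 * P + 24 * K) (hM : M ≤ 2 * m2 * R + 2 * m2 * P)
    (hF : F = K + m2 * P + a * R) :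
    E + M ≤ max ((6 * D + 2 * m2) / a) 24 * F + 6 * D * ω ^ 2 * P := by
  set c₁ := max ((6 * D + 2 * m2) / a) 24 with hc₁
  have h24 : (24 : ℝ) ≤ c₁ := le_max_right _ _
  have hc₁0 : 0 ≤ c₁ := le_trans (by norm_num) h24
  have hRa : (6 * D + 2 * m2) * R ≤ c₁ * (a * R) := by
    have : (6 * D + 2 * m2) / a ≤ c₁ := le_max_left _ _
    have h' : (6 * D + 2 * m2) = (6 * D + 2 * m2) / a * a := by field_simp
    rw [h', mul_assoc]
    exact mul_le_mul_of_nonneg_right this (mul_nonneg ha.le hR)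
  have hK' : 24 * K ≤ c₁ * K := mul_le_mul_of_nonneg_right h24 hK
  have hP' : 2 * m2 * P ≤ c₁ * (m2 * P) := by
    rw [mul_assoc]
    exact mul_le_mul_of_nonneg_right (le_trans (by norm_num) h24) (mul_nonneg hm hP)
  rw [hF]
  nlinarith

end

end Literature.MathematicalPhysics.QuantumFieldTheory.Balaban1983to89.B4Prop31Energy
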